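import Literature.Claims.NS.Prastaro2015
import Literature.Analysis.FluidPDE.EnergyUniqueness
import HarnessLib

/-!
# C29 `Prastaro2015` — kernel refutation of Step 4 (regular compactly supported gluing) and Step 5

Text of record: A. Prástaro, arXiv 1503.07851 v4 (40 pp., PDF page = printed page), Appendix A.
Skeleton p478120 `Literature.Claims.NS.Prastaro2015`.

* `not_exists_regularGlued_d₀`, `not_Step4_concrete : ¬ Step4_concrete`, `not_Step4_physical`,
  `not_Step4_Regularisation_trivial`, `not_Step3_and_Step4 R` — Step 4 = p. 33 l. 60–66 (A.6) +
  closing paragraph p. 34: a compactly supported (in SPACE–TIME) smooth perturbation of a constant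
  solution that is again a global solution and differs from it somewhere does not exist, by forward
  uniqueness of smooth decaying Navier–Stokes solutions from the quiescent slice before the disk
  (`Literature.Analysis.FluidPDE.IsClassicalNSSolutionOn.unique`, Majda–Bertozzi Cor. 3.1).
  Witness medium PHYSICAL: `ρ = C_p = κ = 1`, `χ = -1`, `f ≡ 0`; rest state `s ≡ (0, 0, 0)`;
  `D⁴ = closedBall (3, 0) 2 ⊃ D⁴₀ = closedBall (3, 0) 1` (sup metric on `ℝ × E3`); local solution
  `s₀ ≡ (e₀, 0, 0)` (the paper's own fallback «a different constant value from s», p. 33).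
* `not_Step5_LemmaA3 : ¬ Step5_LemmaA3` — Lemma A3 p. 34 (superposition for the quadratic system
  (66)) fails: `ν_v = (2x₀, -2x₁, 0)` solves the linearisation (A.8) at the rest state but
  `(ν_v·∇)ν_v = (4x₀, 4x₁, 0) ≠ 0`, so `s + ν` violates (66)(C).

WHAT THIS IS NOT: not a claim about NS regularity or blow-up; not a claim about any author beyond the
typed locator.
-/
set_option linter.dupNamespace false

open MeasureTheory Set Function
open scoped ContDiff Laplacian InnerProductSpace

namespace Summit.NavierStokesRegularity.NavierStokesRegularity.Theorems.Prastaro2015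

open Literature.Claims.NS.Prastaro2015 Literature.Analysis.FluidPDE

/-- The medium of the countermodel: `ρ = C_p = κ = 1`, `χ = −1` (Clay viscosity `−χ/ρ = 1`), `f ≡ 0`.
[folklore] -/
noncomputable def m₀ : Medium :=
  ⟨1, 1, 1, -1, fun _ => 0, one_pos, one_pos, one_pos, by norm_num, contDiff_const⟩

/-- In the medium `m₀` every constant section is a global smooth solution (Example 4.5 (66) with
`∇f = 0`). [cite: Prastaro2015Maslov, Example 4.5 (66) p. 28] -/
theorem const_isGlobalSolution (v₀ : E3) (p₀ θ₀ : ℝ) :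
    IsGlobalSolution m₀ (WSection.const v₀ p₀ θ₀) := by
  refine ⟨isOpen_univ, contDiffOn_const, contDiffOn_const, contDiffOn_const, ?_, ?_, ?_⟩
  · intro q _
    simp [EqA, WSection.const, VectorCalculus.divergence]
  · intro q _
    simp [EqC, WSection.const, m₀, gradient_fun_const]
  · intro q _
    simp [EqD, WSection.const, m₀, frobeniusNormSq_zero]

/-- The unit vector `e₀`. [folklore] -/
noncomputable def e0 : E3 := EuclideanSpace.single 0 1

/-- `e₀ ≠ 0`. [folklore] -/
theorem e0_ne_zero : e0 ≠ 0 := by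
  intro h
  have h1 : e0 0 = 1 := by simp [e0]
  rw [h] at h1
  simp at h1

/-- Centre `(3, 0)` of the space-time disks. [folklore] -/
noncomputable def c₀ : ℝ × E3 := (3, 0)

/-- The gluing datum of the countermodel: rest state `s = (0,0,0)`, `D⁴ = closedBall (3,0) 2`,
`D⁴₀ = closedBall (3,0) 1 ⊂ U₀ = ball (3,0) 2`, local solution `s₀ =` the constant flow `(e₀, 0, 0)`.
[cite: Prastaro2015Maslov, Lemma A1 (A.1)–(A.3) p. 32] -/
noncomputable def d₀ : GluingData m₀ where
  s := WSection.const 0 0 0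
  c := c₀
  R := 2
  r := 1
  U₀ := Metric.ball c₀ 2
  s₀ := WSection.const e0 0 0
  s_const := ⟨0, 0, 0, rfl⟩
  s_sol := const_isGlobalSolution 0 0 0
  r_pos := one_pos
  r_lt := by norm_num
  ball_sub := Metric.closedBall_subset_ball (by norm_num)
  U₀_sub := subset_rfl
  s₀_sol := IsSolutionOn.of_global (const_isGlobalSolution e0 0 0) Metric.isOpen_ball
  s₀_ne := ⟨c₀, Metric.mem_closedBall_self zero_le_one, by
    simpa [WSection.eval_const] using e0_ne_zero⟩

/-- Dictionary: a global solution of the medium `m₀` is a classical Navier–Stokes solution with viscosity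
`1` and zero force on every time strip `[0, T)` (two-sided time derivative = one-sided within `[0,T)` for
a globally smooth field). [folklore] -/
theorem classical_of_global {sbar : WSection} (h : IsGlobalSolution m₀ sbar) (T : ℝ) :
    IsClassicalNSSolutionOn (Ico 0 T) 1 0 sbar.v sbar.p where
  smooth_velocity := h.smooth_v.mono (subset_univ _)
  smooth_pressure := h.smooth_p.mono (subset_univ _)
  momentum t ht x := by
    have hsm : ContDiff ℝ ∞ (uncurry sbar.v) := contDiffOn_univ.1 h.smooth_v
    have hline : Differentiable ℝ (fun s => sbar.v s x) :=
      (hsm.comp (contDiff_id.prodMk contDiff_const)).differentiable (by simp)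
    have hdw : timeDerivWithin (Ico 0 T) sbar.v t x = deriv (fun s => sbar.v s x) t :=
      ((hline t).hasDerivAt.hasDerivWithinAt).derivWithin (uniqueDiffOn_Ico 0 T t ht)
    rw [hdw]
    have hC := h.eqC (t, x) (mem_univ _)
    simp only [EqC, m₀, one_smul, neg_smul, gradient_fun_const, smul_zero, add_zero, convect] at hC
    have e : deriv (fun s => sbar.v s x) t + fderiv ℝ (sbar.v t) x (sbar.v t x)
        - ((1 : ℝ) • (Δ (sbar.v t)) x - gradient (sbar.p t) x + (0 : ℝ → E3 → E3) t x)
        = fderiv ℝ (sbar.v t) x (sbar.v t x) + deriv (fun s => sbar.v s x) t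
            + -((Δ (sbar.v t)) x) + gradient (sbar.p t) x := by
      simp only [one_smul, Pi.zero_apply, add_zero]; abel
    rw [convect, ← sub_eq_zero, e, hC]
  divFree t _ x := h.eqA (t, x) (mem_univ _)

/-- A jointly smooth field with compact space-time support has uniform rapid decay on any time set of
unique differentiability (all derivatives are continuous with compact support, hence bounded). [folklore] -/
theorem decay_of_hasCompactSupport {u : ℝ → E3 → E3} (hs : ContDiff ℝ ∞ (uncurry u))
    (hc : HasCompactSupport (uncurry u)) {S : Set ℝ} (hS : UniqueDiffOn ℝ S) :
    HasUniformRapidDecayOn S u := by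
  intro n K
  have hcont : Continuous fun q : ℝ × E3 => (1 + ‖q.2‖) ^ K * ‖iteratedFDeriv ℝ n (uncurry u) q‖ :=
    ((continuous_const.add (continuous_norm.comp continuous_snd)).pow K).mul
      (hs.continuous_iteratedFDeriv (by exact_mod_cast le_top)).norm
  have hsupp : HasCompactSupport
      fun q : ℝ × E3 => (1 + ‖q.2‖) ^ K * ‖iteratedFDeriv ℝ n (uncurry u) q‖ :=
    ((hc.iteratedFDeriv n).norm).mul_left
  obtain ⟨C, hC⟩ := hcont.bounded_above_of_compact_support hsupp
  refine ⟨C, fun t ht x => ?_⟩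
  have hq : ((t, x) : ℝ × E3) ∈ S ×ˢ (univ : Set E3) := ⟨ht, mem_univ _⟩
  rw [iteratedFDerivWithin_eq_iteratedFDeriv (hS.prod uniqueDiffOn_univ)
    (hs.contDiffAt.of_le (by exact_mod_cast le_top)) hq]
  exact le_trans (le_abs_self _) (by simpa [Real.norm_eq_abs] using hC (t, x))

/-- The velocity of a regular glued section for `d₀` has compact space-time support (it is the rest
state off `D⁴`). [cite: Prastaro2015Maslov, (A.6) p. 33] -/
theorem hasCompactSupport_v {sbar : WSection} (h : d₀.RegularGlued sbar) :
    HasCompactSupport (uncurry sbar.v) :=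
  HasCompactSupport.intro (isCompact_closedBall d₀.c d₀.R) fun q hq => by
    show sbar.v q.1 q.2 = 0
    simpa [WSection.eval, d₀] using congrArg Prod.fst (h.2.1 q hq)

/-- The gluing datum `d₀` admits NO regular glued section: a regular glued section's velocity
is a classical Navier–Stokes solution on `[0, 6) × ℝ³` (viscosity `-χ/ρ = 1`, force `-∇f = 0`)
with compact space–time support, vanishing on the quiescent slice `t = 0` (before the disk
`D⁴ = closedBall (3, 0) 2`), hence `≡ 0` on `[0, 6)` by forward uniqueness
(`IsClassicalNSSolutionOn.unique`) — but it equals `s₀.v = e₀ ≠ 0` at the centre `(3, 0) ∈ D⁴₀`.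
Only `d₀.s₀_ne`-type information is used (robust to the (A.3) print wrinkle, ref-3 g2 F1).
[cite: Prastaro2015Maslov, Appendix A p. 33 (A.6), p. 34] -/
theorem not_exists_regularGlued_d₀ : ¬ ∃ sbar, d₀.RegularGlued sbar := by
  rintro ⟨sbar, hsol, hout, hin⟩
  have h₁ := classical_of_global hsol 6
  have h₂ := classical_of_global (const_isGlobalSolution 0 0 0) 6
  have hd₁ : HasUniformRapidDecayOn (Ico 0 6) sbar.v :=
    decay_of_hasCompactSupport (contDiffOn_univ.1 hsol.smooth_v) (hasCompactSupport_v ⟨hsol, hout, hin⟩)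
      (uniqueDiffOn_Ico 0 6)
  have hd₂ : HasUniformRapidDecayOn (Ico 0 6) (WSection.const (0 : E3) 0 0).v :=
    decay_of_hasCompactSupport contDiff_const (HasCompactSupport.intro isCompact_empty fun _ _ => rfl)
      (uniqueDiffOn_Ico 0 6)
  have h0 : sbar.v 0 = (WSection.const (0 : E3) 0 0).v 0 := by
    funext x
    have hq : ((0 : ℝ), x) ∉ Metric.closedBall d₀.c d₀.R := by
      intro hmem
      rw [Metric.mem_closedBall, Prod.dist_eq] at hmem
      have h1 := le_trans (le_max_left _ _) hmem
      simp only [d₀, c₀, Real.dist_eq] at h1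
      norm_num at h1
    simpa [WSection.eval, d₀] using congrArg Prod.fst (hout _ hq)
  have ht3 : (3 : ℝ) ∈ Ico (0 : ℝ) 6 := ⟨by norm_num, by norm_num⟩
  have heq := IsClassicalNSSolutionOn.unique zero_le_one h₁ h₂ hd₁ hd₂ h0 ht3
  have h30 : sbar.v 3 0 = e0 := by
    simpa [WSection.eval, d₀, c₀] using
      congrArg Prod.fst (hin c₀ (Metric.mem_closedBall_self zero_le_one))
  apply e0_ne_zero
  rw [← h30, heq]
  simp [WSection.const]

/-- **Step 4 in its concrete (A.6) form is false** (`Step4_concrete`, print p. 33 l. 60–66 and the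
closing paragraph p. 34 «Ỹ₊∞ is necessarily a regular solution»). [cite: Prastaro2015Maslov, p. 33–34] -/
theorem not_Step4_concrete : ¬ Step4_concrete :=
  fun h => not_exists_regularGlued_d₀ (h m₀ d₀)

/-- The witness medium is PHYSICAL: `ρ, C_p, κ > 0` and `χ < 0` (Clay viscosity `-χ/ρ = 1 > 0`),
`f ≡ 0` (ref-3 g2 REF C29 F2). [cite: Prastaro2015Maslov, Ex. 4.5 p. 27] -/
theorem m₀_physical : 0 < m₀.ρ ∧ 0 < m₀.Cp ∧ 0 < m₀.κ ∧ m₀.χ < 0 ∧ m₀.f = fun _ => 0 :=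
  ⟨one_pos, one_pos, one_pos, by norm_num [m₀], rfl⟩

/-- Print-faithful grain: Step 4 already fails over PHYSICAL media (`ρ, C_p, κ > 0`, `χ < 0`),
i.e. the referee's `Step4Physical` reading is false too. [cite: Prastaro2015Maslov, p. 33–34] -/
theorem not_Step4_physical :
    ¬ ∀ m : Medium, (0 < m.ρ ∧ 0 < m.Cp ∧ 0 < m.κ ∧ m.χ < 0) →
      ∀ d : GluingData m, ∃ sbar, d.RegularGlued sbar :=
  fun h => not_exists_regularGlued_d₀
    (h m₀ ⟨m₀_physical.1, m₀_physical.2.1, m₀_physical.2.2.1, m₀_physical.2.2.2.1⟩ d₀)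

/-- Step 4 under the trivial reading of Lemma A2's objects is false. [cite: Prastaro2015Maslov, p. 33–34] -/
theorem not_Step4_Regularisation_trivial : ¬ Step4_Regularisation Reading.trivial :=
  fun h => not_Step4_concrete (step4_concrete_iff.2 h)

/-- For every reading `R`, Steps 3 and 4 cannot both hold. [cite: Prastaro2015Maslov, Appendix A p. 32–34] -/
theorem not_Step3_and_Step4 (R : (m : Medium) → Reading m) :
    ¬ (Step3_LemmaA2 R ∧ Step4_Regularisation R) :=
  fun h => not_Step4_concrete (step4_concrete_of R h.1 h.2)

/-! ## Step 5 (Example 4.5's route): superposition fails for the quadratic system -/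

/-- Coordinate projections (continuous linear). [folklore] -/
noncomputable abbrev π (i : Fin 3) : E3 →L[ℝ] ℝ := EuclideanSpace.proj i

/-- The unit vector `e₁`. [folklore] -/
noncomputable def e1 : E3 := EuclideanSpace.single 1 1

/-- The linear velocity field `L x = (2x₀, −2x₁, 0) = ∇(x₀² − x₁²)`: divergence free and harmonic, hence a
(time-independent, pressure- and temperature-free) solution of the linearised system at the rest state.
[folklore] -/
noncomputable def L : E3 →L[ℝ] E3 :=
  ((2 : ℝ) • π 0).smulRight e0 + ((-2 : ℝ) • π 1).smulRight e1

/-- `div L = 2 − 2 = 0`. [folklore] -/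
theorem divergence_L (x : E3) : VectorCalculus.divergence (⇑L) x = 0 := by
  rw [divergence_eq_sum_inner_fderiv (EuclideanSpace.basisFun (Fin 3) ℝ), ContinuousLinearMap.fderiv]
  simp [Fin.sum_univ_three, L, e0, e1, inner_add_right, inner_smul_right]

/-- `Δ L = 0` (a linear map has vanishing second derivative). [folklore] -/
@[simp] theorem laplacian_L (x : E3) : (Δ (⇑L : E3 → E3)) x = 0 := by
  have h1 : fderiv ℝ (⇑L : E3 → E3) = fun _ => L := funext fun x => L.fderiv
  rw [InnerProductSpace.laplacian_eq_iteratedFDeriv_stdOrthonormalBasis]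
  simp [iteratedFDeriv_two_apply, h1]

/-- The perturbation `ν₁ = (L, 0, 0)`. [folklore] -/
noncomputable def ν₁ : WSection := ⟨fun _ => ⇑L, fun _ _ => 0, fun _ _ => 0⟩

/-- `ν₁` solves the linearised system at the rest state of `m₀`, globally. [cite: Prastaro2015Maslov, Example 4.5 p. 28] -/
theorem ν₁_lin : IsLinearisedSolutionOn m₀ 0 univ ν₁ := by
  refine ⟨isOpen_univ, ?_, contDiffOn_const, contDiffOn_const, ?_, ?_, ?_⟩
  · exact (L.contDiff.comp contDiff_snd).contDiffOn
  · intro q _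
    exact divergence_L q.2
  · intro q _
    simp [LinEqC, ν₁, m₀, gradient_fun_const]
  · intro q _
    simp [LinEqD, ν₁, m₀]

/-- **Step 5 is false**: `s + ν₁` (rest state plus the linearised solution `ν₁`) violates the motion
equation (C) at `x = e₀`, where `(L·∇)L = L(L e₀) = 4 e₀ ≠ 0` while every other term vanishes.
[cite: Prastaro2015Maslov, Example 4.5 p. 28; Lemma A3 p. 33–34] -/
theorem not_Step5_LemmaA3 : ¬ Step5_LemmaA3 := by
  intro h
  have hsol := h m₀ 0 0 0 (const_isGlobalSolution 0 0 0) univ ν₁ ν₁_lin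
  have hC := hsol.eqC (0, e0) (mem_univ _)
  have h4 := congrArg (fun v : E3 => v 0) hC
  simp [WSection.perturb, WSection.const, ν₁, m₀, gradient_fun_const] at h4
  simp [L, e0, e1] at h4

end Summit.NavierStokesRegularity.NavierStokesRegularity.Theorems.Prastaro2015
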